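import Summits.NavierStokesRegularity.FluidComputer.VorticityOccupationWindow
import Summits.NavierStokesRegularity.FluidComputer.BlockEnergyTransport
import Literature.Analysis.FluidPDE.ConstantinFeffermanHolds
import Literature.Analysis.FluidPDE.NSTaoClassOfSobolevDatum
import Literature.Analysis.FluidPDE.MollifiedSliceTools
import Literature.Analysis.FluidPDE.AncientLPSLiouvilleProofs
import HarnessLib

/-!
# Fluid computer — the level dictionary, GEOMETRIC FACE (L31–L32): the BKM class DISCHARGED on interior windows,
# the vorticity occupation diverges, and the vorticity direction cannot stay coherent (Constantin–Fefferman)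

HONEST FRAMING (cell `pub-fluidc`, verbatim): *low prior, high value-of-information experiment on Tao's
machine paradigm; NOT a claim that NS blows up.* Theorem side of the cell; nothing here is evidence of blow-up.
The tree's vorticity criteria — Beale–Kato–Majda (`beale_kato_majda_holds`) and Constantin–Fefferman
(`constantin_fefferman_holds`), both PROVED in the tree — are stated for classical solutions in the BKM class (all
`L²` Sobolev norms bounded on every closed sub-slab `[0, T'']`). The dictionary's class (maximal smooth +
Leray–Hopf from `u 0`, datum merely in `L²`) is not in that class at `t = 0`; `VorticityOccupationWindow` (gen 3)
therefore kept the BKM-class membership as a hypothesis. This module DISCHARGES it on interior windows and reads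
both criteria as necessities of the dictionary's class. For every maximal smooth solution `(u, p)` of the unforced
Navier–Stokes system on `ℝ³ × [0, T)` (`ν > 0`) which is Leray–Hopf from `u 0`:

* `hasBoundedSobolevNormsOn_translate` — for every `s ∈ (0, T)` the translate `u(· + s)` lies in the BKM class on
  every `[0, T'']`, `T'' < T − s`: every interior slice is an `H^∞` field
  (`BlockEnergyTransport.isSmoothL2Field_slice_of_maximal`), the energy does not increase, and Tao's persistence of
  regularity (`IsClassicalNSSolutionOn.hasBoundedSobolevNormsOn_of_sobolevDatum_unforced`, Tao 2013 Cor. 11.1,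
  PROVED in the tree) propagates all Sobolev norms along the closed slab.
* `lintegral_iSup_curl_window_eq_top` (**L31 — THE BKM FACE, UNCONDITIONAL**): for every `t₀ ∈ [0, T)`,
  `∫_{(t₀, T)} sup_x |curl u(t, x)| dt = ∞` — the vorticity occupation diverges in every terminal window
  (Beale–Kato–Majda 1984), with NO class hypothesis left.
* `vorticityDirection_not_coherent` (**L32 — THE CONSTANTIN–FEFFERMAN FACE**): for every `Ω > 0`, `ρ > 0` and
  `t₀ ∈ [0, T)` it is NOT the case that on `[t₀, T)` the vorticity direction `ξ = ω/|ω|` is `ρ⁻¹`-Lipschitz in the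
  sine of its angle over the region `{|ω| > Ω}`: in every terminal window there are a time `t` and points `x, y`
  with `|ω(x,t)|, |ω(y,t)| > Ω` and `|sin ∠(ξ(x,t), ξ(y,t))| > |x − y|/ρ` (Constantin–Fefferman 1993, contrapositive).

Reading for the machine paradigm (words): a blow-up built from vortex structures cannot keep its intense vortex
lines nearly parallel at scales comparable to their separation — the direction field must kink, in every terminal
window, at every amplitude threshold `Ω` and every coherence length `ρ`; and the running integral of the peak
vorticity must diverge. HONEST SIZE NOTE: qualitative (no rate for the twisting; `Ω`, `ρ` arbitrary); in FORM
checkable against a DNS (`∫ ‖ω‖_∞ dt`, direction-coherence statistics in high-vorticity regions), never against a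
certified atlas number. Necessity only; nothing about sufficiency. 0 sorry; no new definitions, no named facts.

## References

* J. T. Beale, T. Kato, A. Majda, Comm. Math. Phys. 94 (1984) 61–66, Thm. 1. [BealeKatoMajda1984]
* P. Constantin, C. Fefferman, Indiana Univ. Math. J. 42 (1993) 775–789, Theorem (§1).
  [ConstantinFeffermanIndiana1993]
* T. Tao, *Localisation and compactness properties of the Navier–Stokes global regularity problem*, Anal. PDE 6
  (2013) 25–107, Cor. 11.1. [Tao2011]
* A. J. Majda, A. L. Bertozzi, *Vorticity and Incompressible Flow*, CUP 2002, Thm. 3.6. [MajdaBertozzi2002]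
-/

noncomputable section

open MeasureTheory Set Function Filter Topology Metric
open scoped ENNReal NNReal RealInnerProductSpace
open Literature.Analysis.FluidPDE Literature.Analysis.FunctionSpaces
open Summit.NavierStokesRegularity.FluidComputer.BlockEnergyTransport
open Summit.NavierStokesRegularity.FluidComputer.VorticityOccupationWindow

namespace Summit.NavierStokesRegularity.FluidComputer.GeometricFace

/-! ## The BKM class on interior windows -/

/-- **Interior translates of a maximal smooth Leray–Hopf solution lie in the Beale–Kato–Majda class.** For a
maximal smooth solution `(u, p)` of the unforced system on `ℝ³ × [0, T)` (`ν > 0`), Leray–Hopf from `u 0`, every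
`s ∈ (0, T)` and every `T'' < T − s`: all `L²` Sobolev norms of `u(· + s)` are bounded on `[0, T'']`
(`HasBoundedSobolevNormsOn`). The slice `u(s)` is an `H^∞` field (`isSmoothL2Field_slice_of_maximal`), the energy
is bounded by `‖u(0)‖₂²` (Leray's energy inequality), and Tao's persistence of regularity for classical solutions
from `H^∞` data on a closed slab (`IsClassicalNSSolutionOn.hasBoundedSobolevNormsOn_of_sobolevDatum_unforced`)
applies to the translate on `[0, max T'' ((T−s)/2)]`. [cite: Tao2011, Cor. 11.1] -/
theorem hasBoundedSobolevNormsOn_translate {ν T : ℝ} (hν : 0 < ν) (hT : 0 < T)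
    {u : ℝ → EuclideanSpace ℝ (Fin 3) → EuclideanSpace ℝ (Fin 3)} {p : ℝ → EuclideanSpace ℝ (Fin 3) → ℝ}
    (hmax : IsMaximalSmoothSolution ν 0 u p T) (hLH : IsLerayHopfOn T ν 0 (u 0) u)
    {s : ℝ} (hs : s ∈ Ioo 0 T) {T'' : ℝ} (hT'' : T'' < T - s) :
    HasBoundedSobolevNormsOn (Icc 0 T'') (fun t => u (t + s)) := by
  -- enlarge to a positive horizon `T₁ ∈ (0, T - s)`
  set T₁ : ℝ := max T'' ((T - s) / 2) with hT₁
  have hT₁pos : 0 < T₁ := lt_max_of_lt_right (by linarith [hs.2])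
  have hT₁lt : T₁ < T - s := max_lt hT'' (by linarith [hs.2])
  have hle : T'' ≤ T₁ := le_max_left _ _
  suffices h : HasBoundedSobolevNormsOn (Icc 0 T₁) (fun t => u (t + s)) from h.mono (Icc_subset_Icc_right hle)
  -- the translate is classical on the closed slab `[0, T₁]`
  have hcl : IsClassicalNSSolutionOn (Icc 0 T₁) ν 0 (fun t => u (t + s)) (fun t => p (t + s)) :=
    (hmax.1.translate_Ico_zero hs.1.le).mono (Icc_subset_Ico_right hT₁lt) (uniqueDiffOn_Icc hT₁pos)
  -- finite energy along the slab (Leray's energy inequality)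
  have hu0 : MemLp (u 0) 2 volume := hLH.memLp 0 ⟨le_rfl, hT.le⟩
  have hE : ∃ C : ℝ≥0, ∀ t ∈ Icc 0 T₁, ∫⁻ x, ‖(fun t => u (t + s)) t x‖ₑ ^ 2 ≤ C := by
    refine ⟨((eLpNorm (u 0) 2 volume) ^ 2).toNNReal, fun t ht => ?_⟩
    have hts : t + s ∈ Icc 0 T := ⟨by linarith [ht.1, hs.1], by linarith [ht.2, hT₁lt]⟩
    have h2 := eLpNorm_natCast_pow_eq_lintegral volume (u (t + s)) (n := 2) (by norm_num)
    simp only [Nat.cast_ofNat] at h2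
    rw [← h2, ENNReal.coe_toNNReal (ENNReal.pow_ne_top hu0.eLpNorm_ne_top)]
    exact pow_le_pow_left' (hLH.eLpNorm_le_eLpNorm_datum hν.le hu0 hts) 2
  -- the datum `u(s)` is an `H^∞` field
  have h₀ : ∀ m : ℕ, ∫⁻ x, ‖iteratedFDeriv ℝ m ((fun t => u (t + s)) 0) x‖ₑ ^ 2 < ⊤ := by
    intro m
    simpa only [zero_add] using (isSmoothL2Field_slice_of_maximal hν hT hmax hLH hs).sobolev m
  exact hcl.hasBoundedSobolevNormsOn_of_sobolevDatum_unforced hν hT₁pos hE h₀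

/-! ## L31: the BKM face, unconditional -/

/-- **L31 — THE BEALE–KATO–MAJDA FACE, WITH NO CLASS HYPOTHESIS.** For every `ν > 0`, `T > 0` and every maximal
smooth solution `(u, p)` of the unforced Navier–Stokes system on `ℝ³ × [0, T)` which is Leray–Hopf from `u 0`, and
every `t₀ ∈ [0, T)`: `∫⁻_{(t₀, T)} sup_x ‖curl u(t, x)‖ dt = ∞` — the vorticity occupation diverges in every
terminal window. The conditional form `VorticityOccupationWindow.lintegral_iSup_curl_window_eq_top_of_maximal`
applied to the translate at `s = (t₀ + T)/2`, which is maximal (`IsMaximalSmoothSolution.translate_zero`) and in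
the BKM class on every closed sub-slab (`hasBoundedSobolevNormsOn_translate`); the divergence on `(s, T)` is
carried back by translation invariance (`lintegral_Ioo_comp_add_right`) and enlarging the window. [cite: BealeKatoMajda1984, Theorem 1]
[cite: Tao2011, Cor. 11.1] -/
theorem lintegral_iSup_curl_window_eq_top {ν T : ℝ} (hν : 0 < ν) (hT : 0 < T)
    {u : ℝ → EuclideanSpace ℝ (Fin 3) → EuclideanSpace ℝ (Fin 3)} {p : ℝ → EuclideanSpace ℝ (Fin 3) → ℝ}
    (hmax : IsMaximalSmoothSolution ν 0 u p T) (hLH : IsLerayHopfOn T ν 0 (u 0) u)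
    {t₀ : ℝ} (ht₀ : t₀ ∈ Ico 0 T) :
    (∫⁻ t in Ioo t₀ T, ⨆ x, ‖curl (u t) x‖ₑ) = ∞ := by
  set s : ℝ := (t₀ + T) / 2 with hsdef
  have hs : s ∈ Ioo 0 T := ⟨by rw [hsdef]; linarith [ht₀.1, ht₀.2], by rw [hsdef]; linarith [ht₀.2]⟩
  have ht₀s : t₀ < s := by rw [hsdef]; linarith [ht₀.2]
  have hTs : 0 < T - s := sub_pos.2 hs.2
  have hmaxs := hmax.translate_zero hs.1 hs.2
  have hreg : ∀ T'' < T - s, HasBoundedSobolevNormsOn (Icc 0 T'') (fun t => u (t + s)) :=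
    fun T'' hT'' => hasBoundedSobolevNormsOn_translate hν hT hmax hLH hs hT''
  have h := lintegral_iSup_curl_window_eq_top_of_maximal hν.le hTs hmaxs hreg (t₀ := 0) ⟨le_rfl, hTs⟩
  -- carry back: `∫_{(0, T-s)} G(σ + s) dσ = ∫_{(s, T)} G`
  have hshift := lintegral_Ioo_comp_add_right (fun t => ⨆ x, ‖curl (u t) x‖ₑ) s (T - s)
  rw [add_sub_cancel] at hshift
  have h' : (∫⁻ t in Ioo s T, ⨆ x, ‖curl (u t) x‖ₑ) = ∞ := by
    rw [← hshift]
    exact h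
  refine eq_top_iff.2 ?_
  rw [← h']
  exact lintegral_mono_set (Ioo_subset_Ioo_left ht₀s.le)

/-! ## L32: the Constantin–Fefferman face -/

/-- **L32 — THE CONSTANTIN–FEFFERMAN FACE: the vorticity direction cannot stay coherent in any terminal window.**
For every `ν > 0`, `T > 0`, every maximal smooth solution `(u, p)` of the unforced Navier–Stokes system on
`ℝ³ × [0, T)` which is Leray–Hopf from `u 0`, every amplitude threshold `Ω > 0`, every coherence length `ρ > 0` and
every `t₀ ∈ [0, T)`: it is FALSE that for all `t ∈ [t₀, T)` and all `x, y` with `‖curl u(t,x)‖ > Ω`,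
`‖curl u(t,y)‖ > Ω` one has `√(1 − ⟪ξ(t,x), ξ(t,y)⟫²) ≤ ‖x − y‖/ρ` (`ξ = curl u/‖curl u‖`,
`FluidPDE.vorticityDirection`). Otherwise Constantin–Fefferman's theorem (`constantin_fefferman_holds`) applied
to the translate at `s = (t₀ + T)/2` — classical on `[0, T − s)`, in the BKM class on every closed sub-slab by
`hasBoundedSobolevNormsOn_translate` — would continue it past `T − s`, contradicting maximality
(`IsMaximalSmoothSolution.translate_zero`, `HasSobolevExtensionPast.hasSmoothExtensionPast`).
[cite: ConstantinFeffermanIndiana1993, Theorem (§1)] [cite: Tao2011, Cor. 11.1] -/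
theorem vorticityDirection_not_coherent {ν T : ℝ} (hν : 0 < ν) (hT : 0 < T)
    {u : ℝ → EuclideanSpace ℝ (Fin 3) → EuclideanSpace ℝ (Fin 3)} {p : ℝ → EuclideanSpace ℝ (Fin 3) → ℝ}
    (hmax : IsMaximalSmoothSolution ν 0 u p T) (hLH : IsLerayHopfOn T ν 0 (u 0) u)
    {Ω ρ : ℝ} (hΩ : 0 < Ω) (hρ : 0 < ρ) {t₀ : ℝ} (ht₀ : t₀ ∈ Ico 0 T) :
    ¬ (∀ t ∈ Ico t₀ T, ∀ x y : EuclideanSpace ℝ (Fin 3), Ω < ‖curl (u t) x‖ → Ω < ‖curl (u t) y‖ →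
        Real.sqrt (1 - inner ℝ (vorticityDirection (curl (u t)) x) (vorticityDirection (curl (u t)) y) ^ 2) ≤
          ‖x - y‖ / ρ) := by
  intro hdir
  set s : ℝ := (t₀ + T) / 2 with hsdef
  have hs : s ∈ Ioo 0 T := ⟨by rw [hsdef]; linarith [ht₀.1, ht₀.2], by rw [hsdef]; linarith [ht₀.2]⟩
  have ht₀s : t₀ < s := by rw [hsdef]; linarith [ht₀.2]
  have hTs : 0 < T - s := sub_pos.2 hs.2
  have hmaxs := hmax.translate_zero hs.1 hs.2
  have hreg : ∀ T'' < T - s, HasBoundedSobolevNormsOn (Icc 0 T'') (fun t => u (t + s)) :=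
    fun T'' hT'' => hasBoundedSobolevNormsOn_translate hν hT hmax hLH hs hT''
  -- the coherence hypothesis for the translate on `[0, T - s)`
  have hdir' : ∀ t ∈ Ico 0 (T - s), ∀ x y : EuclideanSpace ℝ (Fin 3),
      Ω < ‖curl ((fun t => u (t + s)) t) x‖ → Ω < ‖curl ((fun t => u (t + s)) t) y‖ →
        Real.sqrt (1 - inner ℝ (vorticityDirection (curl ((fun t => u (t + s)) t)) x)
          (vorticityDirection (curl ((fun t => u (t + s)) t)) y) ^ 2) ≤ ‖x - y‖ / ρ :=
    fun t ht x y hx hy => hdir (t + s) ⟨by linarith [ht.1], by linarith [ht.2]⟩ x y hx hy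
  have hext : HasSobolevExtensionPast ν (fun t => u (t + s)) (T - s) :=
    constantin_fefferman_holds hν hTs hΩ hρ hmaxs.1 hreg hdir'
  exact hmaxs.2 hext.hasSmoothExtensionPast

end Summit.NavierStokesRegularity.FluidComputer.GeometricFace

end
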